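import Summits.CriticalPhenomena.PercolationContinuityZ3.Theorems.Transplant.FKDoubleFanOneSidedConeSCross
import Summits.CriticalPhenomena.PercolationContinuityZ3.Theorems.Transplant.FKDoubleFanOneSidedConeSSignsCertA
import Summits.CriticalPhenomena.PercolationContinuityZ3.Theorems.Transplant.FKDoubleFanOneSidedConeSSignsCertB
import Summits.CriticalPhenomena.PercolationContinuityZ3.Theorems.Transplant.FKDoubleFanOneSidedConeSSignsCertC
import HarnessLib

/-!
# Double fans `K₂ ∨ P_{m+1}`: `HypBaS ⟺ cross-positivity of T_b` — the positive functional `e₀` (sup-norm domination by the `e_v`-column sum)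

Helper file (`--supports stmt-CriticalPhenomena-4575`), FK sub-lane `prim-bschramm-fk-3` (gen 39); builds on p205010 (kernel theorem, internal
audit signed; external expert review pending).  No named facts, no sorries; standard axioms.  Memo `bschramm/prim-bschramm-fk-3/FAR-CROSS-XIV.md` §0(F).

`…ConeSSignsCertA/B/C` show that for `F, w ∈ Valid` every hat–Plücker coordinate of `a = imgA q F w` is dominated in absolute value by
**`ellA a := a_uv + a_xv + a_yv + a_zv`**; hence `‖Biv.toFun a‖ ≤ ellA a` (sup norm, **`norm_toFun_imgA_le_ellA`**), and with
**`e0Biv q`** (`⟪β, e0Biv q⟫ = ellA β`, **`pairH_e0Biv`**) the positivity hypothesis of `hypBaS_of_crossPos` (`…ConeSCross`) is discharged with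
`c = 1`: **`hypBaS_of_crossPos'`** — for `0 < q < 1`, cross-positivity of `T_b` on `atomClosure q` (i.e. `⟪T_b β, ρ⟫ ≥ 0` whenever
`β ∈ atomClosure q`, `ρ ∈ OSDualS q`, `⟪β, ρ⟫ = 0`) ALONE implies `HypBaS q`, hence (`negCorr_spokes_cross_far_of_hypBaS`) the far cross-apex
theorem for all middles; **`hypBaS_iff_crossPos`** records the equivalence.  In particular `osConeS q` is a pointed cone with `e0Biv q` in the
interior of its dual.
[folklore]
-/

noncomputable section

namespace Summit.CriticalPhenomena.PercolationContinuityZ3.Theorems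

namespace FK

namespace ThreeApex


/-- The dominating functional `ℓ(a) = a_uv + a_xv + a_yv + a_zv` (the `e_v`-column sum). [folklore] -/
def ellA (β : Biv) : ℝ := β.uv + β.xv + β.yv + β.zv

/-- A coordinatewise bound gives a sup-norm bound for `Biv.toFun`. [folklore] -/
theorem Biv.norm_toFun_le (β : Biv) {r : ℝ} (hr : 0 ≤ r) (h0 : |β.ux| ≤ r) (h1 : |β.uy| ≤ r) (h2 : |β.uz| ≤ r) (h3 : |β.uv| ≤ r)
    (h4 : |β.xy| ≤ r) (h5 : |β.xz| ≤ r) (h6 : |β.xv| ≤ r) (h7 : |β.yz| ≤ r) (h8 : |β.yv| ≤ r) (h9 : |β.zv| ≤ r) :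
    ‖Biv.toFun β‖ ≤ r := by
  refine (pi_norm_le_iff_of_nonneg hr).2 fun i => ?_
  fin_cases i <;> simp [Biv.toFun] <;> assumption

/-- **The sup norm of an `a`-image is dominated by `ℓ`**: `‖a‖∞ ≤ a_uv + a_xv + a_yv + a_zv` on `Valid × Valid` (`0 ≤ q ≤ 1`). [folklore] -/
theorem norm_toFun_imgA_le_ellA {q : ℝ} {F w : V5} (hq0 : 0 ≤ q) (hq1 : q ≤ 1) (hF : Valid q F) (hw : Valid q w) :
    ‖Biv.toFun (imgA q F w)‖ ≤ ellA (imgA q F w) := by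
  have s1 := imgA_ux_nonneg hq1 hF hw; have s2 := imgA_uy_nonneg hq1 hF hw; have s3 := imgA_uz_nonpos hq1 hF hw
  have s4 := imgA_uv_nonneg hq0 hq1 hF hw; have s5 := imgA_xz_nonpos hq1 hF hw; have s6 := imgA_xv_nonneg hq0 hq1 hF hw
  have s7 := imgA_yz_nonpos hq0 hq1 hF hw; have s8 := imgA_yv_nonneg hq0 hq1 hF hw; have s9 := imgA_zv_nonneg hq0 hq1 hF hw
  have b1 := imgA_ell_sub_ux hq0 hq1 hF hw; have b2 := imgA_ell_sub_uy hq0 hq1 hF hw; have b3 := imgA_ell_add_uz hq0 hq1 hF hw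
  have b4 := imgA_ell_add_xz hq0 hq1 hF hw; have b5 := imgA_ell_add_yz hq0 hq1 hF hw; have b6 := imgA_ell_sub_xy hq0 hq1 hF hw
  have b7 := imgA_ell_add_xy hq0 hq1 hF hw
  have h : 0 ≤ ellA (imgA q F w) := by simp only [ellA]; linarith
  simp only [ellA] at *
  refine Biv.norm_toFun_le _ h ?_ ?_ ?_ ?_ ?_ ?_ ?_ ?_ ?_ ?_ <;> rw [abs_le] <;> constructor <;> linarith

/-- The functional `e₀` with `⟪β, e₀⟫ = ℓ(β)` (`q ≠ 1, 2`). [folklore] -/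
def e0Biv (q : ℝ) : Biv := ⟨0, 0, 0, -1 / ((1 - q) * (2 - q)), 0, 0, 1 / (1 - q), 0, 1 / (1 - q), 1 / (1 - q)⟩

/-- `⟪β, e₀⟫ = ℓ(β)` (`q < 1`). [folklore] -/
theorem pairH_e0Biv {q : ℝ} (hq1 : q < 1) (β : Biv) : pairH q β (e0Biv q) = ellA β := by
  have h1 : 1 - q ≠ 0 := by intro h; linarith
  have h2 : 2 - q ≠ 0 := by intro h; linarith
  simp only [pairH, e0Biv, ellA]
  field_simp
  ring

/-- **`HypBaS` from cross-positivity alone** (`0 < q < 1`): the positivity hypothesis of `hypBaS_of_crossPos` is discharged by `e₀` with `c = 1`.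
[folklore] -/
theorem hypBaS_of_crossPos' {q : ℝ} (hq0 : 0 < q) (hq1 : q < 1)
    (hcross : ∀ v ∈ atomClosure q, ∀ ρ : Biv, OSDualS q ρ → pairH q (Biv.ofFun v) ρ = 0 → 0 ≤ pairH q (opTb (Biv.ofFun v)) ρ) :
    HypBaS q :=
  hypBaS_of_crossPos hq0 hq1.le (e0Biv q) one_pos
    (fun F w hF hw => by rw [one_mul, pairH_e0Biv hq1]; exact norm_toFun_imgA_le_ellA hq0.le hq1.le hF.valid hw.valid) hcross

/-- **The exact criterion** (`0 < q < 1`): `HypBaS q` iff `T_b` is cross-positive on the closure of the normalised `a`-images against `OSDualS q`.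
[folklore] -/
theorem hypBaS_iff_crossPos {q : ℝ} (hq0 : 0 < q) (hq1 : q < 1) :
    HypBaS q ↔ ∀ v ∈ atomClosure q, ∀ ρ : Biv, OSDualS q ρ → pairH q (Biv.ofFun v) ρ = 0 → 0 ≤ pairH q (opTb (Biv.ofFun v)) ρ :=
  ⟨crossPos_of_hypBaS, hypBaS_of_crossPos' hq0 hq1⟩


end ThreeApex

end FK

end Summit.CriticalPhenomena.PercolationContinuityZ3.Theorems
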